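import Summits.CriticalPhenomena.PercolationContinuityZ3.Theorems.PercNearOneGluingNoHeavyQuantIndepBlobMoments
import HarnessLib

/-!
# QUANT lane R8, Conjecture DIB\* — GRANULAR SYSTEMS ARE A THEOREM AT EVERY FLOOR: if every blob has size `≤ j/(2x)`
# then the discounted credit row holds (lead g18, LEAD-NOTES-G18 N35 addendum 2)

builds on p205010 (kernel theorem, internal audit signed; external expert review pending)

Support file (`--supports stmt-CriticalPhenomena-4575`), QUANT lane lead (gen 18).  Theorems only, no definitions, no sorries, standard
axioms; vocabulary of `…QuantIndepBlobMoments` (product weights `∏ (if k ∈ W then p k else 1 − p k)`).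

Conjecture DIB\* (`Quant.IndepBlob.DIBStar x`): independent blobs, floor `x`, heavy blobs (`g ≥ x`) credited `a·g`, light blobs credited
`a·κ_x(g)`, `κ_x(g) = (g − x²)/(1 − x)`; credit `> 2j` (and no light giant) ⟹ `P(N ≤ j) ≤ 1 − x`.  KERNEL before this file: `x ≤ 1/2`
(lead g15 `dibStar_of_le_half`, discounted Cantelli), one light, two lights (p1 g12 p264263), small/medium/big light clouds (census-1 g15),
mergeable clouds, companions (lead g16), the floor-split step with a sure largest blob (lead g18 p263914).

**THIS FILE: the GRANULAR family, every floor `0 ≤ x < 1`.**  If EVERY blob satisfies `2x·a ≤ j` (size at most `j/(2x)`: at most `j/2`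
suffices for all floors; for `x ≤ 1/2` this is just 'no giant') and the credit exceeds `2j`, then `P(N ≤ j) ≤ 1 − x`
(`granular_smallBall`, real weights / heavy-set form; `tail_ge_of_granular`, the `DIBStar` binder shape with natural sizes).
PROOF — lead g15's discounted Cantelli with the size cap in place of the floor cap: per blob `g(1 − g) ≤ (1 − x)(2g − c)` where `c` is the
credit rate (heavy: `⟺ g ≥ x`; light: `(1 − x)(2g − κ_x(g)) − g(1 − g) = (g − x)²`), so with `m = Σ a g ≥ credit > 2j` and `V = Σ a²g(1−g)`:
`2x·V ≤ j·Σ a g(1−g) ≤ j(1 − x)(2m − credit) < 2j(1 − x)(m − j) ≤ 2(1 − x)(m − j)²` (as `m − j > j`), i.e. `x·V < (1 − x)(m − j)²`, which is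
exactly Cantelli's `P(N ≤ j) ≤ V/(V + (m − j)²) ≤ 1 − x`.

CONSEQUENCE for T-DIB (ARCHITECTURE FS, lead g17/g18): the 'SMALL' cell of the floor-split step — largest blob `b` with `2b ≤ j` — needs NO
split at all (`2x·a ≤ 2x·b ≤ x·j ≤ j`); with `stepFS_sure` (sure largest blob) and `dibStar_of_twoLights` (p1 g12) the open class of
Conjecture DIB\* is the LUMPY core: `1/2 < x < 1`, the largest blob has size `> j/(2x)` and gate `< 1`, at least three non-empty light blobs.
Numerical second check (explore/t17.py, 78 034 random granular instances at floors in (0.05, 0.99)): Cantelli's floor ≥ x in every case,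
minimal normalised margin 0.017 (the chain is strict but thin: it is sharp as `m ↓ 2j`, `a ↑ j/(2x)`, all gates at the floor).

NOVELTY.  presearch: 'Cantelli / one-sided Chebyshev small-ball bound for weighted Bernoulli sums with summands bounded by half the
threshold' → textbook second-moment method (Paley–Zygmund, Cantelli 1928; Alon–Spencer §4) gives the tool, not the discounted-credit
statement; nothing closer in corpus hybrid/vsearch or galaxy ('Cantelli inequality|one-sided Chebyshev').  [this work; this lane's census];
the gluing rows served [cite: KozmaNitzan2024, Conjecture 3 (p. 15)]; product weights [cite: Grimmett1999, §1.3 p. 10].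
-/

namespace Summit.CriticalPhenomena.PercolationContinuityZ3.Theorems

namespace Quant

namespace IndepBlob

open Finset

variable {ι : Type*} [Fintype ι] [DecidableEq ι]

/-- **Granular discounted small-ball inequality (every floor).**  Gates `0 ≤ p i ≤ 1`, weights `a i ≥ 0`, a floor `0 ≤ p₀ < 1`, a heavy set
`H` (`p₀ ≤ p i` on `H`, `p i ≤ p₀` off `H`), credited mean `m_c = Σ_{i∈H} a i p i + Σ_{i∉H} a i (p i − p₀²)/(1 − p₀)`, a real level `j` with
`2j < m_c`, and the SIZE CAP `2 p₀ · a i ≤ j` for every blob.  Then `Σ_{W : a(W) ≤ j} w(W) ≤ 1 − p₀`. [this work] -/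
theorem granular_smallBall (p a : ι → ℝ) (p₀ : ℝ) (hp₀ : 0 ≤ p₀) (hp₀1 : p₀ < 1)
    (hp0 : ∀ i, 0 ≤ p i) (hp1 : ∀ i, p i ≤ 1) (ha : ∀ i, 0 ≤ a i) (H : Finset ι)
    (hH : ∀ i ∈ H, p₀ ≤ p i) (hL : ∀ i, i ∉ H → p i ≤ p₀) (j : ℝ)
    (hj : 2 * j < (∑ i ∈ H, a i * p i) + ∑ i ∈ Hᶜ, a i * ((p i - p₀ ^ 2) / (1 - p₀)))
    (hcap : ∀ i, 2 * p₀ * a i ≤ j) :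
    ∑ W ∈ (Finset.univ : Finset (Finset ι)).filter (fun W => ∑ i ∈ W, a i ≤ j),
      (∏ k, if k ∈ W then p k else 1 - p k) ≤ 1 - p₀ := by
  set mc : ℝ := (∑ i ∈ H, a i * p i) + ∑ i ∈ Hᶜ, a i * ((p i - p₀ ^ 2) / (1 - p₀)) with hmc
  set m : ℝ := ∑ i, a i * p i with hm
  set s : ℝ := m - j with hs
  set V : ℝ := ∑ i, a i ^ 2 * p i * (1 - p i) with hV
  set K := (Finset.univ : Finset (Finset ι)).filter (fun W => ∑ i ∈ W, a i ≤ j) with hK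
  set P : ℝ := ∑ W ∈ K, (∏ k, if k ∈ W then p k else 1 - p k) with hP
  show P ≤ 1 - p₀
  have hf0 : 0 < 1 - p₀ := by linarith
  have hw0 : ∀ W, 0 ≤ (∏ k, if k ∈ W then p k else 1 - p k) := bernoulliWeight_nonneg hp0 hp1
  have hP0 : 0 ≤ P := Finset.sum_nonneg fun W _ => hw0 W
  have hP1 : P ≤ 1 := by
    rw [← sum_bernoulliWeight p]
    exact Finset.sum_le_sum_of_subset_of_nonneg (Finset.filter_subset _ _) fun W _ _ => hw0 W
  -- the credited mean is below the true mean
  have hsplit_m : m = (∑ i ∈ H, a i * p i) + ∑ i ∈ Hᶜ, a i * p i := by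
    rw [hm, ← Finset.sum_add_sum_compl H]
  have hlight_le : ∀ i, i ∉ H → a i * ((p i - p₀ ^ 2) / (1 - p₀)) ≤ a i * p i := by
    intro i hi
    refine mul_le_mul_of_nonneg_left ?_ (ha i)
    rw [div_le_iff₀ hf0]
    nlinarith [hL i hi, hp0 i, hp₀]
  have hmc_le_m : mc ≤ m := by
    rw [hsplit_m, hmc]
    refine add_le_add le_rfl (Finset.sum_le_sum fun i hi => hlight_le i (Finset.mem_compl.1 hi))
  have hm0 : 0 ≤ m := Finset.sum_nonneg fun i _ => mul_nonneg (ha i) (hp0 i)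
  -- `s = m − j > max(j, 0)`
  have hsj : j < s := by rw [hs]; linarith
  have hspos : 0 < s := by
    rcases le_or_gt 0 j with hj0 | hj0
    · linarith
    · rw [hs]; linarith
  -- the variance bound `2 p₀ V ≤ j (1 − p₀) (2m − m_c)`
  have hVle : 2 * p₀ * V ≤ j * (1 - p₀) * (2 * m - mc) := by
    have hheavy : ∀ i ∈ H, 2 * p₀ * (a i ^ 2 * p i * (1 - p i)) ≤ j * (1 - p₀) * (a i * p i) := by
      intro i hi
      have hpi0 : 0 ≤ p i := hp0 i
      have e1 : p i * (1 - p i) ≤ (1 - p₀) * p i := by nlinarith [hH i hi]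
      have c0 : 0 ≤ a i * (p i * (1 - p i)) := mul_nonneg (ha i) (mul_nonneg hpi0 (by linarith [hp1 i]))
      calc 2 * p₀ * (a i ^ 2 * p i * (1 - p i)) = (2 * p₀ * a i) * (a i * (p i * (1 - p i))) := by ring
        _ ≤ j * (a i * (p i * (1 - p i))) := mul_le_mul_of_nonneg_right (hcap i) c0
        _ ≤ j * (a i * ((1 - p₀) * p i)) := by
            have hj0 : 0 ≤ j := by nlinarith [hcap i, ha i, hp₀]
            exact mul_le_mul_of_nonneg_left (mul_le_mul_of_nonneg_left e1 (ha i)) hj0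
        _ = j * (1 - p₀) * (a i * p i) := by ring
    have hlight : ∀ i ∈ Hᶜ, 2 * p₀ * (a i ^ 2 * p i * (1 - p i)) ≤
        j * (1 - p₀) * (2 * (a i * p i) - a i * ((p i - p₀ ^ 2) / (1 - p₀))) := by
      intro i _
      have hpi0 : 0 ≤ p i := hp0 i
      -- the discount identity: `(1 − p₀)(2g − κ(g)) − g(1 − g) = (g − p₀)²`
      have key : p i * (1 - p i) ≤ (1 - p₀) * (2 * p i - (p i - p₀ ^ 2) / (1 - p₀)) := by
        have e : (1 - p₀) * (2 * p i - (p i - p₀ ^ 2) / (1 - p₀)) = p i * (1 - p i) + (p i - p₀) ^ 2 := by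
          field_simp
          ring
        rw [e]
        nlinarith [sq_nonneg (p i - p₀)]
      have c0 : 0 ≤ a i * (p i * (1 - p i)) := mul_nonneg (ha i) (mul_nonneg hpi0 (by linarith [hp1 i]))
      have hj0 : 0 ≤ j := by nlinarith [hcap i, ha i, hp₀]
      calc 2 * p₀ * (a i ^ 2 * p i * (1 - p i)) = (2 * p₀ * a i) * (a i * (p i * (1 - p i))) := by ring
        _ ≤ j * (a i * (p i * (1 - p i))) := mul_le_mul_of_nonneg_right (hcap i) c0
        _ ≤ j * (a i * ((1 - p₀) * (2 * p i - (p i - p₀ ^ 2) / (1 - p₀)))) :=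
            mul_le_mul_of_nonneg_left (mul_le_mul_of_nonneg_left key (ha i)) hj0
        _ = j * (1 - p₀) * (2 * (a i * p i) - a i * ((p i - p₀ ^ 2) / (1 - p₀))) := by ring
    have hsum : 2 * p₀ * V ≤ j * (1 - p₀) * (∑ i ∈ H, a i * p i) +
        j * (1 - p₀) * (2 * (∑ i ∈ Hᶜ, a i * p i) - ∑ i ∈ Hᶜ, a i * ((p i - p₀ ^ 2) / (1 - p₀))) := by
      rw [hV, ← Finset.sum_add_sum_compl H, mul_add, Finset.mul_sum, Finset.mul_sum]
      have h1 : ∑ i ∈ H, 2 * p₀ * (a i ^ 2 * p i * (1 - p i)) ≤ j * (1 - p₀) * (∑ i ∈ H, a i * p i) := by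
        rw [Finset.mul_sum]; exact Finset.sum_le_sum hheavy
      have h2 : ∑ i ∈ Hᶜ, 2 * p₀ * (a i ^ 2 * p i * (1 - p i)) ≤
          j * (1 - p₀) * (2 * (∑ i ∈ Hᶜ, a i * p i) - ∑ i ∈ Hᶜ, a i * ((p i - p₀ ^ 2) / (1 - p₀))) := by
        rw [Finset.mul_sum, ← Finset.sum_sub_distrib, Finset.mul_sum]
        exact Finset.sum_le_sum hlight
      exact add_le_add h1 h2
    have e : j * (1 - p₀) * (∑ i ∈ H, a i * p i) +
        j * (1 - p₀) * (2 * (∑ i ∈ Hᶜ, a i * p i) - ∑ i ∈ Hᶜ, a i * ((p i - p₀ ^ 2) / (1 - p₀))) =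
        j * (1 - p₀) * (2 * m - mc) := by
      rw [hsplit_m, hmc]; ring
    rw [← e]; exact hsum
  have hV0 : 0 ≤ V := Finset.sum_nonneg fun i _ => by
    have hpi0 : 0 ≤ p i := hp0 i
    have : 0 ≤ 1 - p i := by linarith [hp1 i]
    positivity
  -- hence `p₀ V ≤ (1 − p₀) s²`
  have hVs : p₀ * V ≤ (1 - p₀) * s ^ 2 := by
    rcases le_or_gt j 0 with hj0 | hj0
    · -- `j ≤ 0`: the cap forces `p₀ · a i = 0`-ish; directly `2 p₀ V ≤ j(1−p₀)(2m − mc) ≤ 0`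
      have h2m : 0 ≤ 2 * m - mc := by linarith
      have hprod : 0 ≤ (-j) * ((1 - p₀) * (2 * m - mc)) := mul_nonneg (by linarith) (mul_nonneg hf0.le h2m)
      have : 2 * p₀ * V ≤ 0 := hVle.trans (by linarith)
      nlinarith [sq_nonneg s, hf0.le, mul_nonneg hp₀ hV0]
    · have h2m : 2 * m - mc ≤ 2 * s := by rw [hs]; linarith
      have h3 : j * (1 - p₀) * (2 * m - mc) ≤ j * (1 - p₀) * (2 * s) :=
        mul_le_mul_of_nonneg_left h2m (mul_nonneg hj0.le hf0.le)
      have h4 : j * (1 - p₀) * (2 * s) ≤ s * (1 - p₀) * (2 * s) := by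
        have c0 : 0 ≤ (1 - p₀) * (2 * s) := by positivity
        nlinarith [hsj.le, c0]
      nlinarith [hVle, h3, h4]
  -- Cantelli at deviation `s` from the true mean: `(s + u)² P ≤ V + u²`
  have cantelli : ∀ u : ℝ, 0 ≤ u → (s + u) ^ 2 * P ≤ V + u ^ 2 := by
    intro u hu
    have q0 := sum_bernoulliWeight_mul_sq_sub p a (m + u)
    rw [← hm] at q0
    have b0 : (s + u) ^ 2 * P ≤ ∑ W : Finset ι, (∏ k, if k ∈ W then p k else 1 - p k) * (m + u - ∑ i ∈ W, a i) ^ 2 := by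
      rw [hP, Finset.mul_sum]
      calc ∑ W ∈ K, (s + u) ^ 2 * (∏ k, if k ∈ W then p k else 1 - p k)
          ≤ ∑ W ∈ K, (∏ k, if k ∈ W then p k else 1 - p k) * (m + u - ∑ i ∈ W, a i) ^ 2 := by
            refine Finset.sum_le_sum fun W hW => ?_
            rw [hK, Finset.mem_filter] at hW
            have hge : s + u ≤ m + u - ∑ i ∈ W, a i := by rw [hs]; linarith [hW.2]
            have hsq : (s + u) ^ 2 ≤ (m + u - ∑ i ∈ W, a i) ^ 2 :=
              pow_le_pow_left₀ (by linarith) hge 2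
            rw [mul_comm]
            exact mul_le_mul_of_nonneg_left hsq (hw0 W)
        _ ≤ ∑ W : Finset ι, (∏ k, if k ∈ W then p k else 1 - p k) * (m + u - ∑ i ∈ W, a i) ^ 2 :=
            Finset.sum_le_sum_of_subset_of_nonneg (Finset.filter_subset _ _)
              fun W _ _ => mul_nonneg (hw0 W) (sq_nonneg _)
    have e : (m + u - m) ^ 2 + V = V + u ^ 2 := by ring
    calc (s + u) ^ 2 * P ≤ ∑ W : Finset ι, (∏ k, if k ∈ W then p k else 1 - p k) * (m + u - ∑ i ∈ W, a i) ^ 2 := b0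
      _ = (m + u - m) ^ 2 + V := by rw [q0]
      _ = V + u ^ 2 := e
  -- choose `u = V / s`
  have hc := cantelli (V / s) (div_nonneg hV0 hspos.le)
  have hsne : s ≠ 0 := hspos.ne'
  have e3 : (s + V / s) * s = s ^ 2 + V := by
    field_simp
  have lhs : (s + V / s) ^ 2 * P * s ^ 2 = (s ^ 2 + V) ^ 2 * P := by
    rw [← e3]; ring
  have rhs : (V + (V / s) ^ 2) * s ^ 2 = V * (s ^ 2 + V) := by
    field_simp
  have h4 : (s ^ 2 + V) ^ 2 * P ≤ V * (s ^ 2 + V) := by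
    have := mul_le_mul_of_nonneg_right hc (sq_nonneg s)
    rw [lhs, rhs] at this
    exact this
  have hpos : 0 < s ^ 2 + V := by positivity
  have key : (s ^ 2 + V) * P ≤ V := by
    have h5 : (s ^ 2 + V) * ((s ^ 2 + V) * P) ≤ (s ^ 2 + V) * V := by
      calc (s ^ 2 + V) * ((s ^ 2 + V) * P) = (s ^ 2 + V) ^ 2 * P := by ring
        _ ≤ V * (s ^ 2 + V) := h4
        _ = (s ^ 2 + V) * V := by ring
    exact le_of_mul_le_mul_left h5 hpos
  -- conclude: `s² P ≤ V(1 − P)` and `p₀ V ≤ (1 − p₀) s²` give `p₀ P ≤ (1 − p₀)(1 − P)`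
  have hs2 : 0 < s ^ 2 := by positivity
  have s1 : s ^ 2 * P ≤ V * (1 - P) := by linear_combination key
  have s2 : p₀ * (V * (1 - P)) ≤ (1 - p₀) * s ^ 2 * (1 - P) := by
    have := mul_le_mul_of_nonneg_right hVs (by linarith : 0 ≤ 1 - P)
    linarith [this]
  have s3 : p₀ * P ≤ (1 - p₀) * (1 - P) := by
    refine le_of_mul_le_mul_left ?_ hs2
    calc s ^ 2 * (p₀ * P) = p₀ * (s ^ 2 * P) := by ring
      _ ≤ p₀ * (V * (1 - P)) := mul_le_mul_of_nonneg_left s1 hp₀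
      _ ≤ (1 - p₀) * s ^ 2 * (1 - P) := s2
      _ = s ^ 2 * ((1 - p₀) * (1 - P)) := by ring
  linarith

/-- **DIB\* for GRANULAR systems, every floor** (`DIBStar`'s binder shape).  Floor `0 ≤ x < 1`, sizes `a : κ → ℕ` with `2x·a k ≤ j` for every
blob, gates in `[0,1]`, discounted credit `Σ_k a k·(g k | (g k − x²)/(1 − x)) > 2j` ⟹ `x ≤ P(N ≥ j + 1)`.  (No other hypothesis: light
sizes `≤ j` follow from the cap when `x ≥ 1/2`, and are not needed.) [this work] -/
theorem tail_ge_of_granular {κ : Type*} [Fintype κ] [DecidableEq κ] (x : ℝ) (hx0 : 0 ≤ x) (hx1 : x < 1)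
    (a : κ → ℕ) (g : κ → ℝ) (j : ℕ) (hg : ∀ k, 0 ≤ g k ∧ g k ≤ 1) (hcap : ∀ k, 2 * x * (a k : ℝ) ≤ j)
    (hcredit : (2 * j : ℝ) < ∑ k, (a k : ℝ) * (if x ≤ g k then g k else (g k - x ^ 2) / (1 - x))) :
    x ≤ ∑ W : Finset κ, (∏ k, if k ∈ W then g k else 1 - g k) * (if j + 1 ≤ ∑ k ∈ W, a k then (1 : ℝ) else 0) := by
  set H : Finset κ := Finset.univ.filter (fun k => x ≤ g k) with hH
  have hmemH : ∀ k, k ∈ H ↔ x ≤ g k := fun k => by simp [hH]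
  have hsplit : ∑ k, (a k : ℝ) * (if x ≤ g k then g k else (g k - x ^ 2) / (1 - x)) =
      (∑ k ∈ H, (a k : ℝ) * g k) + ∑ k ∈ Hᶜ, (a k : ℝ) * ((g k - x ^ 2) / (1 - x)) := by
    rw [← Finset.sum_add_sum_compl H]
    congr 1
    · exact Finset.sum_congr rfl fun k hk => by rw [if_pos ((hmemH k).1 hk)]
    · exact Finset.sum_congr rfl fun k hk => by rw [if_neg (fun h' => (Finset.mem_compl.1 hk) ((hmemH k).2 h'))]
  have row := granular_smallBall g (fun k => (a k : ℝ)) x hx0 hx1 (fun k => (hg k).1) (fun k => (hg k).2)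
    (fun k => Nat.cast_nonneg (a k)) H (fun k hk => (hmemH k).1 hk)
    (fun k hk => (not_le.1 fun h' => hk ((hmemH k).2 h')).le) (j : ℝ) (by rw [← hsplit]; exact hcredit) hcap
  -- complement: `P(N ≥ j+1) = 1 − P(N ≤ j)`
  have hfilt : (Finset.univ : Finset (Finset κ)).filter (fun W => ∑ k ∈ W, (a k : ℝ) ≤ (j : ℝ)) =
      (Finset.univ : Finset (Finset κ)).filter (fun W => ∑ k ∈ W, a k ≤ j) := by
    ext W
    simp only [Finset.mem_filter, Finset.mem_univ, true_and]
    rw [← Nat.cast_sum, Nat.cast_le]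
  rw [hfilt, Finset.sum_filter] at row
  have hsum : ∑ W : Finset κ, (∏ k, if k ∈ W then g k else 1 - g k) * (if j + 1 ≤ ∑ k ∈ W, a k then (1 : ℝ) else 0) =
      ∑ W : Finset κ, ((∏ k, if k ∈ W then g k else 1 - g k) -
        (if ∑ k ∈ W, a k ≤ j then (∏ k, if k ∈ W then g k else 1 - g k) else 0)) := by
    refine Finset.sum_congr rfl fun W _ => ?_
    by_cases hW : ∑ k ∈ W, a k ≤ j
    · rw [if_pos hW, if_neg (by omega), mul_zero, sub_self]
    · rw [if_neg hW, if_pos (by omega), mul_one, sub_zero]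
  rw [hsum, Finset.sum_sub_distrib, sum_bernoulliWeight]
  linarith

/-- **The SMALL cell of the floor-split step needs no split**: if the LARGEST blob `b` has `2b ≤ j` then every blob has `2x·a ≤ x·j ≤ j`,
so `tail_ge_of_granular` applies at every floor `x < 1`. [this work] -/
theorem tail_ge_of_maxSize_le_half {κ : Type*} [Fintype κ] [DecidableEq κ] (x : ℝ) (hx0 : 0 ≤ x) (hx1 : x < 1)
    (a : κ → ℕ) (g : κ → ℝ) (j : ℕ) (hg : ∀ k, 0 ≤ g k ∧ g k ≤ 1) (hhalf : ∀ k, 2 * a k ≤ j)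
    (hcredit : (2 * j : ℝ) < ∑ k, (a k : ℝ) * (if x ≤ g k then g k else (g k - x ^ 2) / (1 - x))) :
    x ≤ ∑ W : Finset κ, (∏ k, if k ∈ W then g k else 1 - g k) * (if j + 1 ≤ ∑ k ∈ W, a k then (1 : ℝ) else 0) := by
  refine tail_ge_of_granular x hx0 hx1 a g j hg (fun k => ?_) hcredit
  have h2 : (2 : ℝ) * (a k : ℝ) ≤ (j : ℝ) := by exact_mod_cast hhalf k
  have ha0 : (0 : ℝ) ≤ (a k : ℝ) := Nat.cast_nonneg _
  nlinarith [mul_nonneg ha0 (sub_nonneg.2 hx1.le)]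

end IndepBlob

end Quant

end Summit.CriticalPhenomena.PercolationContinuityZ3.Theorems
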